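import Summits.BirchSwinnertonDyer.BirchSwinnertonDyer.Theorems.TwoAdicConverseModFourTraceSquareDiscriminant
import HarnessLib

/-!
# Route `TwoAdicConverse` (rung S3), crux `OrdLambdaHalfAtTwo` (item 19556): the PARITY of `a_ℓ` is the existence of a root of
# the `2`-division cubic modulo `ℓ`

Cell `bsd-2adic`, seat `bsd-2adic-conv-1` (GEN 21). THEOREMS ONLY — no named fact, no definition, nothing conditional. The
dictionary used (in prose) by the irreducible-`E[2]` lines of item 19556 — F1Sign2's `lambdaCorrectionAtTwo` («`2^{n_ℓ+1}` at a
good prime with `a_ℓ` even `⇔ 2 ∣ #Ẽ(𝔽_ℓ)`») and reserve `elliptic-shadow-two`'s `shadowCorrectionAtTwo` («parity of `a_ℓ` ↔ `ℓ`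
has a degree-one prime in `K`») — as a kernel statement: for a globally minimal `W/ℚ` and an odd good prime `ℓ`,
**`a_ℓ` is even ⟺ `2 ∣ #W̃(𝔽_ℓ)` ⟺ the `2`-division cubic `ψ₂² = 4x³ + b₂x² + 2b₄x + b₆` has a root in `𝔽_ℓ`** (a root is the
abscissa of an `𝔽_ℓ`-point of order `2`, Lagrange; no root ⇒ no element of order `2`, Cauchy). Sequel of
`TwoAdicConverseModFourTraceSquareDiscriminant` (its §2 lemmas `exists_two_torsion_of_root`, `not_two_dvd_natCard_point_of_no_root`).

* `two_dvd_natCard_point_iff_exists_root` — elliptic `V` over a finite field with `2 ≠ 0`;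
* `two_dvd_reductionPointCount_iff_exists_root`, **`even_frobeniusTrace_iff_exists_root`** — for `W/ℚ` at an odd good `ℓ`, the roots
  taken in `ZMod ℓ` with the integer invariants `b₂, b₄, b₆` of the minimal model;
* `odd_frobeniusTrace_iff_forall_ne_zero` — the contrapositive reading («`a_ℓ` odd ⟺ `ψ₂²` has no root mod `ℓ` ⟺ Frobenius is a
  `3`-cycle on `E[2]`»; the last equivalence is prose only).

HONEST FRAMING: elementary; nothing about `λ` or BSD; items 19556 / 19218 stay OPEN; BSD is not proved by any of this. PARTITION (D-0054):
none — RANK axis (S3). References: J. H. Silverman, *AEC* (2009), III.2.3, V.2.3.1, VII.2 [SilvermanAEC2009].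
-/

set_option linter.dupNamespace false
set_option autoImplicit false

noncomputable section

open scoped Classical
open WeierstrassCurve Literature.NumberTheory.EllipticCurves

namespace Summit.BirchSwinnertonDyer.BirchSwinnertonDyer.Theorems.TwoAdicTwistConverse

section Field

variable {F : Type*} [Field F] [Finite F] (V : WeierstrassCurve F) [V.IsElliptic]

/-- **`2 ∣ #V(𝔽)` iff `ψ₂²` has a root in `𝔽`** (elliptic `V` over a finite field with `2 ≠ 0`): a root carries a point of order
`2` (Lagrange); with no root there is no element of order `2` (Cauchy). [cite: SilvermanAEC2009, III.2.3] -/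
theorem two_dvd_natCard_point_iff_exists_root (h2 : (2 : F) ≠ 0) :
    2 ∣ Nat.card V.toAffine.Point ↔ ∃ x : F, 4 * x ^ 3 + V.b₂ * x ^ 2 + 2 * V.b₄ * x + V.b₆ = 0 := by
  constructor
  · intro h
    by_contra hno
    push Not at hno
    exact not_two_dvd_natCard_point_of_no_root V hno h
  · rintro ⟨x, hx⟩
    obtain ⟨y, hn, hP⟩ := exists_two_torsion_of_root V h2 hx
    exact two_dvd_natCard_of_two_torsion (a := Affine.Point.some x y hn) (Affine.Point.some_ne_zero _) hP

end Field

section Rat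

variable (W : WeierstrassCurve ℚ) [W.IsElliptic] [W.IsGloballyMinimal] (ℓ : ℕ) [Fact ℓ.Prime]

omit [W.IsElliptic] in
/-- **`2 ∣ #W̃(𝔽_ℓ)` iff the `2`-division cubic has a root mod `ℓ`** (odd good `ℓ`; `b₂, b₄, b₆` the integer invariants of the minimal
model). [cite: SilvermanAEC2009, III.2.3 and VII.2] -/
theorem two_dvd_reductionPointCount_iff_exists_root (hℓ : ℓ ≠ 2) (hgood : W.HasGoodReductionAtPrime ℓ) :
    2 ∣ W.reductionPointCount ℓ ↔ ∃ x : ZMod ℓ, 4 * x ^ 3 + ((integralModelInt W).b₂ : ZMod ℓ) * x ^ 2 +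
      2 * ((integralModelInt W).b₄ : ZMod ℓ) * x + ((integralModelInt W).b₆ : ZMod ℓ) = 0 := by
  have hΔℓ : ¬ (ℓ : ℤ) ∣ minimalDiscriminantInt W := not_dvd_minimalDiscriminantInt_of_hasGoodReductionAtPrime' W ℓ hgood
  haveI hE : (reductionModPrime W ℓ).IsElliptic := isElliptic_reductionModPrime W hΔℓ
  have h2F : (2 : ZMod ℓ) ≠ 0 := by
    intro h
    have h' : ((2 : ℕ) : ZMod ℓ) = 0 := by exact_mod_cast h
    rw [ZMod.natCast_eq_zero_iff] at h'
    exact hℓ ((Nat.prime_dvd_prime_iff_eq Fact.out Nat.prime_two).mp h')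
  rw [reductionPointCount_eq_natCard_point, two_dvd_natCard_point_iff_exists_root (reductionModPrime W ℓ) h2F]
  simp only [reductionModPrime, map_b₂, map_b₄, map_b₆, eq_intCast]

omit [W.IsElliptic] in
/-- **`a_ℓ` is even iff the `2`-division cubic has a root mod `ℓ`** (odd good `ℓ`; `a_ℓ = ℓ + 1 − #W̃(𝔽_ℓ)`, `ℓ + 1` even): the parity
dictionary of the `λ`-correction at `2` / of the degree-one primes of `ℚ(E[2]-root)`. [cite: SilvermanAEC2009, III.2.3 and V.2.3.1] -/
theorem even_frobeniusTrace_iff_exists_root (hℓ : ℓ ≠ 2) (hgood : W.HasGoodReductionAtPrime ℓ) :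
    Even (W.frobeniusTrace ℓ) ↔ ∃ x : ZMod ℓ, 4 * x ^ 3 + ((integralModelInt W).b₂ : ZMod ℓ) * x ^ 2 +
      2 * ((integralModelInt W).b₄ : ZMod ℓ) * x + ((integralModelInt W).b₆ : ZMod ℓ) = 0 := by
  rw [← two_dvd_reductionPointCount_iff_exists_root W ℓ hℓ hgood, WeierstrassCurve.frobeniusTrace]
  obtain ⟨k, hk⟩ := (Fact.out : ℓ.Prime).odd_of_ne_two hℓ
  have hℓ' : (ℓ : ℤ) = 2 * k + 1 := by exact_mod_cast hk
  rw [Int.even_iff, ← Int.natCast_dvd_natCast, Int.dvd_iff_emod_eq_zero, hℓ']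
  push_cast
  omega

omit [W.IsElliptic] in
/-- **`a_ℓ` is odd iff the `2`-division cubic has NO root mod `ℓ`** (odd good `ℓ`) — i.e. iff Frobenius at `ℓ` fixes no point of
`E[2] ∖ {O}`. [cite: SilvermanAEC2009, III.2.3 and V.2.3.1] -/
theorem odd_frobeniusTrace_iff_forall_ne_zero (hℓ : ℓ ≠ 2) (hgood : W.HasGoodReductionAtPrime ℓ) :
    Odd (W.frobeniusTrace ℓ) ↔ ∀ x : ZMod ℓ, 4 * x ^ 3 + ((integralModelInt W).b₂ : ZMod ℓ) * x ^ 2 +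
      2 * ((integralModelInt W).b₄ : ZMod ℓ) * x + ((integralModelInt W).b₆ : ZMod ℓ) ≠ 0 := by
  rw [← Int.not_even_iff_odd, even_frobeniusTrace_iff_exists_root W ℓ hℓ hgood]
  push Not
  rfl

end Rat

end Summit.BirchSwinnertonDyer.BirchSwinnertonDyer.Theorems.TwoAdicTwistConverse

end
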